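import Summits.CriticalPhenomena.Ising3DConformalLimit.Theorems.IsingEuclidUpgradeR4NonGaussianDefs
import Summits.CriticalPhenomena.Ising3DConformalLimit.Theorems.MoebiusLimitExists.Negative.EtaExists
import Literature.Probability.LatticeModels.PointwiseScalingLimitTwoPointMono
import Literature.Probability.LatticeModels.CriticalScalingDimension
import HarnessLib

/-!
# Crux `IsingEuclidUpgradeR4NonGaussian` (stmt-CriticalPhenomena-0636), line
# `free-covariance-delta-dichotomy`: the registered stub `stub_etaExists`

THEOREM-ONLY file (no definitions, no named facts). Under the crux hypotheses with an index,
`IsLimitWithIndex ρ S Δ` (= `ρ > 0` on `(0,1]`, `HasPointwiseScalingLimit (criticalCorr 3) ρ S`,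
`IsNondegenerateTwoPoint S`, `HasIndex ρ Δ` — vocabulary of
`Theorems/IsingEuclidUpgradeR4NonGaussianDefs.lean`), the lattice exponent `η` of `ℤ³` EXISTS in the
logarithmic sense and equals `2Δ - 1`:
`log ⟨σ₀σ_x⟩_{β_c} / log ‖x‖ → -2Δ` along `cofinite`, i.e. `HasIsingExponentEta 3 (2Δ - 1)`.

The proof is the rotation-free version of the tree theorem
`MoebiusLimitExistsNegative.hasIsingExponentEta_of_covariantLimit`
(`Theorems/MoebiusLimitExists/Negative/EtaExists.lean`), whose shell lemmas
(`isCompact_shell_configs`, `smul_siteVec_mem_shell`, `rescaledCorrelator_zero_smul_siteVec`,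
`norm_mem_Icc_of_shell`) are re-used by import:

* (a) TWO-SIDED BOUNDS ON THE SHELL without rotations: for `y` with `1 ≤ ‖y‖_∞ ≤ 2`,
  `0 < m := S₂(0, 7e₀) ≤ S₂(0, y) ≤ M := S₂(0, e₀/4)` by the Messager–Miracle-Solé comparison in the
  limit (`HasPointwiseScalingLimit.two_le_two_of_mul_norm_lt`, `3·2 < 7`, `3·(1/4) < 1`);
* (b) THE RENORMALISATION without scale covariance of `S`: `HasIndex ρ Δ` at `c = 2⁻¹` along the
  dyadic meshes `δ_k = 2^{-(k+1)}` gives `log ρ(δ_{k+1})² - log ρ(δ_k)² → 2Δ log 2`, hence by Cesàro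
  `log ρ(δ_k)² / k → 2Δ log 2`;
* (c) uniform convergence on the compact shell reaches every lattice point `2^{k+1} ≤ ‖x‖_∞ < 2^{k+2}`
  exactly at mesh `δ_k`, and the `ε/log` bookkeeping of the template goes through with `|Δ|` in the
  scale-bracket term (no sign of `Δ` is needed).

References: A. Messager, S. Miracle-Solé, J. Stat. Phys. 17 (1977) 245–262 (monotonicity of
correlations); P. Di Francesco, P. Mathieu, D. Sénéchal, *Conformal Field Theory* (1997) §4.3.1.
-/

noncomputable section

namespace Summit.CriticalPhenomena.Ising3DConformalLimit.Cruxes.IsingEuclidUpgradeR4NonGaussian.FreeCovarianceDeltaDichotomy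

open Literature.Probability.LatticeModels Filter Set
open scoped Topology

/-! ### (b) The renormalisation along the dyadic meshes, from the index at `c = 1/2` -/

/-- From `HasIndex ρ Δ` at `c = 2⁻¹` along `δ_k = 2^{-(k+1)}`: the logarithmic increments
`log ρ(δ_{k+1})² - log ρ(δ_k)² → 2Δ log 2`. [folklore] -/
theorem tendsto_log_rho_sq_sub_of_hasIndex {ρ : ℝ → ℝ} {Δ : ℝ} (hidx : HasIndex ρ Δ)
    (hρ : ∀ δ ∈ Set.Ioc (0:ℝ) 1, 0 < ρ δ) :
    Tendsto (fun k : ℕ => Real.log (ρ ((2:ℝ)⁻¹ ^ (k + 1 + 1)) ^ 2) -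
        Real.log (ρ ((2:ℝ)⁻¹ ^ (k + 1)) ^ 2)) atTop (𝓝 (2 * Δ * Real.log 2)) := by
  have hρk : ∀ k : ℕ, 0 < ρ ((2:ℝ)⁻¹ ^ (k + 1)) := fun k =>
    hρ _ ⟨dyadicMesh_pos k, dyadicMesh_le_one k⟩
  have hhalf : (0:ℝ) < 2⁻¹ := by norm_num
  have h1 : Tendsto (fun k : ℕ => ρ ((2:ℝ)⁻¹ ^ (k + 1 + 1)) / ρ ((2:ℝ)⁻¹ ^ (k + 1))) atTop
      (𝓝 (((2:ℝ)⁻¹) ^ (-Δ))) := by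
    refine ((hidx 2⁻¹ hhalf).comp tendsto_dyadicMesh).congr fun k => ?_
    simp only [Function.comp_apply]
    rw [← pow_succ']
  have hne : ((2:ℝ)⁻¹) ^ (-Δ) ≠ 0 := (Real.rpow_pos_of_pos hhalf _).ne'
  have h2 := h1.log hne
  have hlog : Real.log (((2:ℝ)⁻¹) ^ (-Δ)) = Δ * Real.log 2 := by
    rw [Real.log_rpow hhalf, Real.log_inv]; ring
  rw [hlog] at h2
  have h3 := h2.const_mul 2
  rw [show 2 * Δ * Real.log 2 = 2 * (Δ * Real.log 2) by ring]
  refine h3.congr fun k => ?_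
  rw [Real.log_div (hρk (k + 1)).ne' (hρk k).ne', Real.log_pow, Real.log_pow]
  push_cast
  ring

/-- **`log ρ(δ_k)² / k → 2Δ log 2`** from the index (Cesàro average of the telescoping increments;
the tree's `tendsto_log_rho_sq_div` with scale covariance of `S` replaced by `HasIndex ρ Δ`). [folklore] -/
theorem tendsto_log_rho_sq_div_of_hasIndex {ρ : ℝ → ℝ} {Δ : ℝ} (hidx : HasIndex ρ Δ)
    (hρ : ∀ δ ∈ Set.Ioc (0:ℝ) 1, 0 < ρ δ) :
    Tendsto (fun k : ℕ => Real.log (ρ ((2:ℝ)⁻¹ ^ (k + 1)) ^ 2) / k) atTop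
      (𝓝 (2 * Δ * Real.log 2)) := by
  -- adapted from `Literature.Probability.LatticeModels.tendsto_log_rho_sq_div`
  set u : ℕ → ℝ := fun k => Real.log (ρ ((2:ℝ)⁻¹ ^ (k + 1)) ^ 2) with hu
  have hces := (tendsto_log_rho_sq_sub_of_hasIndex hidx hρ).cesaro
  have htel : ∀ k : ℕ, ∑ i ∈ Finset.range k, (u (i + 1) - u i) = u k - u 0 :=
    fun k => Finset.sum_range_sub u k
  have h1 : Tendsto (fun k : ℕ => (k:ℝ)⁻¹ * (u k - u 0)) atTop (𝓝 (2 * Δ * Real.log 2)) := by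
    refine hces.congr fun k => ?_
    simp only [hu] at htel ⊢
    rw [htel k]
  have h2 : Tendsto (fun k : ℕ => (k:ℝ)⁻¹ * u 0) atTop (𝓝 0) := by
    have := tendsto_inv_atTop_zero.comp (tendsto_natCast_atTop_atTop (R := ℝ))
    simpa using this.mul_const (u 0)
  have h3 := h1.add h2
  rw [add_zero] at h3
  refine h3.congr fun k => ?_
  simp only [hu]
  ring

/-! ### (a) Two-sided bounds on the shell, by Messager–Miracle-Solé in the limit -/

/-- The sup norm of `t e₀ ∈ ℝ³` is `|t|`. [folklore] -/
theorem norm_ofLp_single_fin_three (t : ℝ) :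
    ‖WithLp.ofLp (EuclideanSpace.single (0 : Fin 3) t)‖ = |t| := by
  rw [PiLp.ofLp_single, Pi.norm_single, Real.norm_eq_abs]

/-- **MMS in the limit on the shell**: for `y` with `1 ≤ ‖y‖_∞ ≤ 2`,
`S₂(0, 7e₀) ≤ S₂(0, y) ≤ S₂(0, e₀/4)` (`3·2 < 7`, `3·(1/4) < 1`;
`HasPointwiseScalingLimit.two_le_two_of_mul_norm_lt`). [cite: MessagerMiracleSoleJSP1977, Theorem (monotonicity)] -/
theorem shell_two_point_bounds {ρ : ℝ → ℝ} {S : CorrFamily 3}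
    (hlim : HasPointwiseScalingLimit (criticalCorr 3) ρ S) {y : EuclideanSpace ℝ (Fin 3)}
    (h2 : ∀ i, |y i| ≤ 2) (h1 : ∃ i, 1 ≤ |y i|) :
    S 2 ![0, EuclideanSpace.single 0 (7:ℝ)] ≤ S 2 ![0, y] ∧
      S 2 ![0, y] ≤ S 2 ![0, EuclideanSpace.single 0 (4⁻¹:ℝ)] := by
  have hsup_le : ‖WithLp.ofLp y‖ ≤ 2 := by
    refine (pi_norm_le_iff_of_nonneg (by norm_num)).2 fun i => ?_
    rw [Real.norm_eq_abs]
    exact h2 i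
  have hsup_ge : 1 ≤ ‖WithLp.ofLp y‖ := by
    obtain ⟨i, hi⟩ := h1
    have := norm_le_pi_norm (WithLp.ofLp y) i
    rw [Real.norm_eq_abs] at this
    exact hi.trans this
  have hy0 : y ≠ 0 := by
    intro h
    rw [h, WithLp.ofLp_zero, norm_zero] at hsup_ge
    exact absurd hsup_ge (by norm_num)
  have hy : (![0, y] : Fin 2 → EuclideanSpace ℝ (Fin 3)) ∈ NonCoincident 3 2 :=
    pair_mem_nonCoincident (Ne.symm hy0)
  have h7 := zero_unitVec_mem_nonCoincident (t := (7:ℝ)) (by norm_num)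
  have h4 := zero_unitVec_mem_nonCoincident (t := (4⁻¹:ℝ)) (by norm_num)
  constructor
  · refine hlim.two_le_two_of_mul_norm_lt (by norm_num) hy h7 ?_
    simp only [Matrix.cons_val_zero, Matrix.cons_val_one, Matrix.cons_val_fin_one,
      WithLp.ofLp_zero, zero_sub, norm_neg, norm_ofLp_single_fin_three, Nat.cast_ofNat]
    rw [abs_of_pos (by norm_num)]
    linarith
  · refine hlim.two_le_two_of_mul_norm_lt (by norm_num) h4 hy ?_
    simp only [Matrix.cons_val_zero, Matrix.cons_val_one, Matrix.cons_val_fin_one,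
      WithLp.ofLp_zero, zero_sub, norm_neg, norm_ofLp_single_fin_three, Nat.cast_ofNat]
    rw [abs_of_pos (by norm_num)]
    linarith


/-! ### The main theorem -/

section Main

open Summit.CriticalPhenomena.Ising3DConformalLimit.MoebiusLimitExistsNegative

/-- **A non-degenerate pointwise scaling limit of the critical correlators on `ℤ³` whose
renormalisation has index `-Δ` forces the anomalous dimension to exist, `η = 2Δ − 1`:**
`log ⟨σ₀σ_x⟩_{β_c} / log ‖x‖_∞ → −2Δ` as `x → ∞` in `ℤ³`. No rotation invariance, continuity or
scale covariance of `S` is used: the two-sided bounds on the compact shell `1 ≤ ‖y‖_∞ ≤ 2` come from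
the Messager–Miracle-Solé comparison in the limit, and `log ρ(2^{-(k+1)})²/k → 2Δ log 2` from the
index. [cite: FrancescoMathieuSenechal1997, §4.3.1 eq. (4.56)] -/
theorem hasIsingExponentEta_of_isLimitWithIndex {ρ : ℝ → ℝ} {S : CorrFamily 3} {Δ : ℝ}
    (h : IsLimitWithIndex ρ S Δ) : HasIsingExponentEta 3 (2 * Δ - 1) := by
  -- adapted from `MoebiusLimitExistsNegative.hasIsingExponentEta_of_covariantLimit`
  obtain ⟨hρ, hlim, hnd, hidx⟩ := h
  -- constants
  set m : ℝ := S 2 ![0, EuclideanSpace.single 0 (7:ℝ)] with hmdef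
  set M : ℝ := S 2 ![0, EuclideanSpace.single 0 (4⁻¹:ℝ)] with hMdef
  have hm : 0 < m := hnd _ (zero_unitVec_mem_nonCoincident (by norm_num))
  -- the shell and its configurations
  set T : Set (EuclideanSpace ℝ (Fin 3)) := {y | (∀ i, |y i| ≤ 2) ∧ ∃ i, 1 ≤ |y i|} with hTdef
  set K : Set (Fin 2 → EuclideanSpace ℝ (Fin 3)) :=
    (fun y : EuclideanSpace ℝ (Fin 3) => (![0, y] : Fin 2 → EuclideanSpace ℝ (Fin 3))) '' T with hKdef
  have hKc : IsCompact K := isCompact_shell_configs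
  have hTne : ∀ y ∈ T, y ≠ 0 := by
    intro y hy h0
    have := (norm_mem_Icc_of_shell hy.1 hy.2).1
    rw [h0, norm_zero] at this
    linarith
  have hKs : K ⊆ NonCoincident 3 2 := by
    rintro _ ⟨y, hy, rfl⟩
    exact pair_mem_nonCoincident (Ne.symm (hTne y hy))
  have hSK : ∀ y ∈ T, m ≤ S 2 ![0, y] ∧ S 2 ![0, y] ≤ M := fun y hy =>
    shell_two_point_bounds hlim hy.1 hy.2
  -- uniform convergence on K within m/2
  have hU : TendstoUniformlyOn (rescaledCorrelator (criticalCorr 3) ρ 2) (S 2) (𝓝[>] 0) K :=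
    (tendstoLocallyUniformlyOn_iff_forall_isCompact (isOpen_nonCoincident 3 2)).1 (hlim 2) K hKs hKc
  have hev : ∀ᶠ δ in 𝓝[>] (0:ℝ), ∀ y ∈ T,
      m / 2 < rescaledCorrelator (criticalCorr 3) ρ 2 δ ![0, y] ∧
        rescaledCorrelator (criticalCorr 3) ρ 2 δ ![0, y] < M + m / 2 := by
    filter_upwards [Metric.tendstoUniformlyOn_iff.1 hU (m / 2) (half_pos hm)] with δ hδ y hy
    have h := hδ _ ⟨y, hy, rfl⟩
    rw [Real.dist_eq] at h
    have h' := abs_sub_lt_iff.1 h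
    obtain ⟨hl, hu⟩ := hSK y hy
    constructor <;> linarith [h'.1, h'.2]
  -- along the dyadic meshes: bounds for ALL lattice points of the k-th dyadic shell
  have hevk : ∀ᶠ k : ℕ in atTop, ∀ x : Site 3, 2 ^ (k + 1) ≤ Site.supNorm x →
      Site.supNorm x < 2 ^ (k + 2) →
        m / 2 < ρ ((2:ℝ)⁻¹ ^ (k + 1)) ^ 2 * criticalTwoPoint 3 x ∧
          ρ ((2:ℝ)⁻¹ ^ (k + 1)) ^ 2 * criticalTwoPoint 3 x < M + m / 2 := by
    filter_upwards [tendsto_dyadicMesh.eventually hev] with k hk x hlo hhi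
    have h := hk _ (smul_siteVec_mem_shell hlo hhi)
    rwa [rescaledCorrelator_zero_smul_siteVec] at h
  -- the renormalisation: `log ρ(δ_k)² / k → 2Δ log 2`
  have hrho := tendsto_log_rho_sq_div_of_hasIndex hidx hρ
  -- ε-management
  have hl2 : 0 < Real.log 2 := Real.log_pos one_lt_two
  set L : ℝ := Real.log 2 with hLdef
  set c : ℝ := 2 * Δ * L with hcdef
  set Θ : ℝ := max |Real.log (m / 2)| |Real.log (M + m / 2)| with hΘdef
  unfold HasIsingExponentEta HasSpatialDecayExponent
  have htarget : (-(((3:ℕ):ℝ) - 2 + (2 * Δ - 1))) = -(2 * Δ) := by push_cast; ring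
  rw [htarget, Metric.tendsto_nhds]
  intro ε hε
  -- choose k₁
  have hε' : 0 < ε * L / 2 := by positivity
  have hrho' : ∀ᶠ k : ℕ in atTop,
      |Real.log (ρ ((2:ℝ)⁻¹ ^ (k + 1)) ^ 2) / k - c| < ε * L / 2 := by
    have := (Metric.tendsto_nhds.1 hrho) _ hε'
    simpa only [Real.dist_eq] using this
  have htail : ∀ᶠ k : ℕ in atTop, (Θ + 4 * |Δ| * L) / ((k + 1) * L) < ε / 2 := by
    have ht : Tendsto (fun k : ℕ => (Θ + 4 * |Δ| * L) / ((k + 1) * L)) atTop (𝓝 0) := by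
      have h1 : Tendsto (fun k : ℕ => ((k:ℝ) + 1) * L) atTop atTop :=
        (tendsto_natCast_atTop_atTop.atTop_add tendsto_const_nhds).atTop_mul_const hl2
      exact tendsto_const_nhds.div_atTop h1
    filter_upwards [(Metric.tendsto_nhds.1 ht) _ (half_pos hε)] with k hk
    rw [Real.dist_eq, sub_zero] at hk
    exact lt_of_abs_lt hk
  obtain ⟨k₁, hk₁⟩ := eventually_atTop.1 (hevk.and (hrho'.and (htail.and (eventually_ge_atTop 1))))
  -- the exceptional set is contained in a finite box
  have hfin : {x : Site 3 | Site.supNorm x < 2 ^ (k₁ + 1)}.Finite := by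
    refine (box 3 (2 ^ (k₁ + 1))).finite_toSet.subset fun x hx => ?_
    rw [Finset.mem_coe, mem_box_iff_supNorm_le]
    exact le_of_lt hx
  rw [Filter.eventually_cofinite]
  refine hfin.subset fun x hx => ?_
  -- contrapositive: for `‖x‖_∞ ≥ 2^{k₁+1}` the estimate holds
  rw [Set.mem_setOf_eq] at hx ⊢
  by_contra hge
  push Not at hge
  apply hx
  -- the dyadic scale of x
  set N := Site.supNorm x with hNdef
  have hNpos : 0 < N := lt_of_lt_of_le (by positivity) hge
  set k : ℕ := Nat.log 2 N - 1 with hkdef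
  have hlogN : k₁ + 1 ≤ Nat.log 2 N := Nat.le_log_of_pow_le one_lt_two hge
  have hk1 : k + 1 = Nat.log 2 N := by omega
  have hkk₁ : k₁ ≤ k := by omega
  have hlo : 2 ^ (k + 1) ≤ N := by rw [hk1]; exact Nat.pow_log_le_self 2 hNpos.ne'
  have hhi : N < 2 ^ (k + 2) := by
    rw [show k + 2 = (Nat.log 2 N).succ by omega]
    exact Nat.lt_pow_succ_log_self one_lt_two N
  obtain ⟨hkx, hkρ, hkt, hk1'⟩ := hk₁ k hkk₁
  obtain ⟨hGlo, hGhi⟩ := hkx x hlo hhi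
  -- notation
  set r : ℝ := ρ ((2:ℝ)⁻¹ ^ (k + 1)) ^ 2 with hrdef
  set g : ℝ := criticalTwoPoint 3 x with hgdef
  have hrpos : 0 < r := pow_pos (hρ _ ⟨dyadicMesh_pos k, dyadicMesh_le_one k⟩) 2
  have hgpos : 0 < g := by
    by_contra h
    push Not at h
    have : r * g ≤ 0 := mul_nonpos_of_nonneg_of_nonpos hrpos.le h
    linarith [half_pos hm]
  -- logs
  have hθ : |Real.log (r * g)| ≤ Θ := by
    have h1 : Real.log (m / 2) < Real.log (r * g) := Real.log_lt_log (half_pos hm) hGlo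
    have h2 : Real.log (r * g) < Real.log (M + m / 2) := Real.log_lt_log (by positivity) hGhi
    rw [abs_le]
    have := neg_abs_le (Real.log (m / 2))
    have := le_max_left |Real.log (m / 2)| |Real.log (M + m / 2)|
    have := le_abs_self (Real.log (M + m / 2))
    have := le_max_right |Real.log (m / 2)| |Real.log (M + m / 2)|
    constructor <;> linarith
  have hlogg : Real.log g = Real.log (r * g) - Real.log r := by
    rw [Real.log_mul hrpos.ne' hgpos.ne']; ring
  -- the norm of x and its logarithm ℓ
  set ℓ : ℝ := Real.log ‖x‖ with hℓdef
  set kk : ℝ := (k : ℝ) with hkkdef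
  have hnorm : ‖x‖ = (N : ℝ) := Site.norm_eq_supNorm x
  have hNreal : (2:ℝ) ^ (k + 1) ≤ N := by exact_mod_cast hlo
  have hNreal' : (N : ℝ) ≤ 2 ^ (k + 2) := by exact_mod_cast hhi.le
  have hNpos' : (0:ℝ) < N := by exact_mod_cast hNpos
  have hℓlo : kk * L + L ≤ ℓ := by
    have h := Real.log_le_log (by positivity) hNreal
    rw [Real.log_pow] at h; push_cast at h; rw [hℓdef, hnorm]; linarith
  have hℓhi : ℓ ≤ kk * L + 2 * L := by
    have h := Real.log_le_log hNpos' hNreal'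
    rw [Real.log_pow] at h; push_cast at h; rw [hℓdef, hnorm]; linarith
  have hℓpos : 0 < ℓ := by
    have : 0 ≤ kk * L := by positivity
    linarith
  have hkpos : (0:ℝ) < kk := by rw [hkkdef]; exact_mod_cast hk1'
  -- (A) the renormalisation term
  have hA : |c * kk - Real.log r| ≤ ε / 2 * (kk * L) := by
    have e : (Real.log r / kk - c) * kk = Real.log r - c * kk := by
      rw [sub_mul, div_mul_cancel₀ _ hkpos.ne']
    calc |c * kk - Real.log r| = |(Real.log r / kk - c) * kk| := by rw [e, abs_sub_comm]
      _ = |Real.log r / kk - c| * kk := by rw [abs_mul, abs_of_pos hkpos]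
      _ ≤ (ε * L / 2) * kk := mul_le_mul_of_nonneg_right hkρ.le hkpos.le
      _ = ε / 2 * (kk * L) := by ring
  -- (B) the scale-bracket term (no sign of `Δ` is needed)
  have hd0 : 0 ≤ ℓ - kk * L := by linarith
  have hd2 : ℓ - kk * L ≤ 2 * L := by linarith
  have hB : |2 * Δ * (ℓ - kk * L)| ≤ 4 * |Δ| * L := by
    rw [abs_mul, abs_mul, abs_two, abs_of_nonneg hd0]
    calc 2 * |Δ| * (ℓ - kk * L) ≤ 2 * |Δ| * (2 * L) :=
          mul_le_mul_of_nonneg_left hd2 (by positivity)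
      _ = 4 * |Δ| * L := by ring
  -- assemble
  rw [Real.dist_eq]
  have hkey : Real.log g / ℓ - -(2 * Δ) =
      ((c * kk - Real.log r) + Real.log (r * g) + 2 * Δ * (ℓ - kk * L)) / ℓ := by
    rw [eq_div_iff hℓpos.ne', hlogg, hcdef]
    field_simp
    ring
  rw [hkey, abs_div, abs_of_pos hℓpos, div_lt_iff₀ hℓpos]
  have htri := abs_add_three (c * kk - Real.log r) (Real.log (r * g)) (2 * Δ * (ℓ - kk * L))
  have htail' : Θ + 4 * |Δ| * L < ε / 2 * ((kk + 1) * L) := by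
    have hden : (0:ℝ) < (kk + 1) * L := by positivity
    have := hkt
    rwa [div_lt_iff₀ hden] at this
  have hkl : kk * L ≤ ℓ := by
    have : 0 ≤ L := hl2.le
    linarith
  have hkl' : (kk + 1) * L ≤ ℓ := by linarith
  have step1 : |c * kk - Real.log r| + |Real.log (r * g)| + |2 * Δ * (ℓ - kk * L)| ≤
      ε / 2 * (kk * L) + Θ + 4 * |Δ| * L := add_le_add (add_le_add hA hθ) hB
  have step2 : ε / 2 * (kk * L) + Θ + 4 * |Δ| * L <
      ε / 2 * (kk * L) + ε / 2 * ((kk + 1) * L) := by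
    linarith
  have step3 : ε / 2 * (kk * L) + ε / 2 * ((kk + 1) * L) ≤ ε / 2 * ℓ + ε / 2 * ℓ :=
    add_le_add (mul_le_mul_of_nonneg_left hkl (by positivity))
      (mul_le_mul_of_nonneg_left hkl' (by positivity))
  have step4 : ε / 2 * ℓ + ε / 2 * ℓ = ε * ℓ := by ring
  exact (htri.trans step1).trans_lt ((step2.trans_le step3).trans_eq step4)

end Main

/-- **Registered stub `stub_etaExists`** of the line `free-covariance-delta-dichotomy`: under the
crux hypotheses with index `Δ` (`IsLimitWithIndex ρ S Δ`), the critical exponent `η` of `ℤ³` exists in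
the logarithmic sense and equals `2Δ - 1` (`HasIsingExponentEta 3 (2Δ - 1)`, the hypothesis of
Duminil-Copin–Panis 2025 Thm 1.5). [cite: FrancescoMathieuSenechal1997, §4.3.1 eq. (4.56)] -/
theorem stub_etaExists :
    ∀ (ρ : ℝ → ℝ) (S : CorrFamily 3) (Δ : ℝ), IsLimitWithIndex ρ S Δ →
      HasIsingExponentEta 3 (2 * Δ - 1) :=
  fun _ _ _ h => hasIsingExponentEta_of_isLimitWithIndex h

end Summit.CriticalPhenomena.Ising3DConformalLimit.Cruxes.IsingEuclidUpgradeR4NonGaussian.FreeCovarianceDeltaDichotomy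

end
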